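import Summits.HodgeConjecture.HodgeConjecture.Theses.CyclicUnitaryPowers
import Summits.HodgeConjecture.HodgeConjecture.Theorems.CyclicUnitaryPowersEigenHodgeNumbersAffine
import Literature.AlgebraicGeometry.HodgeTheory.CyclicCoverEigenHodgeNumbers
import Literature.AlgebraicGeometry.HodgeTheory.CompleteIntersectionHodgeLocusCodim
import Literature.AlgebraicGeometry.Motives.GeneralNonsingularForms
import Mathlib.RingTheory.MvPolynomial.EulerIdentity
import Mathlib.RingTheory.RootsOfUnity.Complex

/-!
# Route `CyclicUnitaryPowers`, crux K1-A (`VeryGeneralDeckCommutatorsInHg`, stmt-HodgeConjecture-19544):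
# the model stub `stub_cyclicDeckHodge` (line `unitary-reflection-zariski` v5)

For a nonsingular ternary form `f` of prime degree `p ≥ 7` with smooth projective `p`-cyclic cover
`X_F = V₊(x₃^p − f) ⊂ ℙ³` and deck transformation `σ_F : x₃ ↦ ζ_p x₃`, clauses (iii) and (iv) of the
route's `Deck` hold on the model, GIVEN the two Carlson–Toledo facts typed in
`Literature/AlgebraicGeometry/HodgeTheory/CyclicCoverEigenHodgeNumbers`:

* (iii) `dim_ℚ H²(X_F;ℚ)^{σ_F^*} = 1` is the named fact `carlsonToledo1999_finrank_eigenspace_deck_one`;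
* (iv) with `ζ := exp(2πi/p)` (`Complex.isPrimitiveRoot_exp`), the named fact
  `carlsonToledo1999_finrank_eigenspace_inf_hodgePiece` gives
  `dim (H²(X_F)_{ζ^j} ∩ H^{2−q,q}) = dim R_f^{(q+1)p−3−j}`; since `f` is nonsingular its partials have no
  common zero `≠ 0` (Euler + `IsNonsingularForm.exists_eval_pderiv_ne_zero`), so a power of every variable
  lies in the Jacobian ideal (`exists_X_pow_mem_jacobianIdeal_ternary`) and the Hilbert function of `R_f` is
  the complete-intersection count (`hilbert_jacobianIdeal_eq_card`, `card_filter_finsuppAntidiag_eq_ciHilbert`),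
  which is the route's closed form `ehn`: the triple Cauchy product of the all-ones list of length `p − 1`
  is `ciHilbert [p−1, p−1, p−1]` (`getD_foldl_pm_replicate`, by induction on the number of factors).

References: J. Carlson, D. Toledo, *Discriminant complements and kernels of monodromy representations*,
Duke Math. J. 97 (1999), §§2, 5; C. Voisin, *Hodge Theory and Complex Algebraic Geometry II* (2003), §6.1.3
Thm. 6.10, Cor. 6.12 and §6.2.2; R. Kloosterman (2023), §2 eq. (1) (the count `ciHilbert`).
-/

namespace Summit.HodgeConjecture.HodgeConjecture.Theorems.CyclicUnitaryPowersDeckHodge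

open Finset
open Literature.AlgebraicGeometry.Kloosterman2023 (ciHilbert ciHilbert_nil ciHilbert_cons)
-- the list bookkeeping for the route's Cauchy product `pmul` is REUSED from the landed W-stub file (gate dedup rule)
open Summit.HodgeConjecture.HodgeConjecture.Theorems.CyclicUnitaryPowersEigenHodgeNumbersAffine
  (list_sum_map_range_eq cauchy_getD getD_replicate_one getD_singleton_one)

section Conv

variable (pm : List ℕ → List ℕ → List ℕ)
  (hpm : ∀ a b, pm a b = (List.range (a.length + b.length - 1)).map fun k =>
    ((List.range (k + 1)).map fun i => a.getD i 0 * b.getD (k - i) 0).sum)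
include hpm

/-- One Cauchy factor `(1 + t + ⋯ + t^{n−1})`: entry `m` of `pmul a [1,…,1]` is `Σ_{j<n, j≤m} a_{m−j}` — the
recursion of `ciHilbert` (`ciHilbert_cons`). [cite: Kloosterman2023, §2 eq. (1)] -/
theorem getD_pm_replicate_one (a : List ℕ) (n m : ℕ) :
    (pm a (List.replicate n 1)).getD m 0 =
      ((List.range n).map fun j => if j ≤ m then a.getD (m - j) 0 else 0).sum := by
  rw [hpm, cauchy_getD, list_sum_map_range_eq]
  simp_rw [getD_replicate_one, mul_ite, mul_one, mul_zero]
  rw [← Finset.sum_filter, ← Finset.sum_filter]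
  refine Finset.sum_nbij' (fun i => m - i) (fun j => m - j) ?_ ?_ ?_ ?_ ?_
  · intro i hi
    simp only [Finset.mem_filter, Finset.mem_range] at hi ⊢
    omega
  · intro j hj
    simp only [Finset.mem_filter, Finset.mem_range] at hj ⊢
    omega
  · intro i hi
    simp only [Finset.mem_filter, Finset.mem_range] at hi
    show m - (m - i) = i
    omega
  · intro j hj
    simp only [Finset.mem_filter, Finset.mem_range] at hj
    show m - (m - j) = j
    omega
  · intro i hi
    simp only [Finset.mem_filter, Finset.mem_range] at hi
    show a.getD i 0 = a.getD (m - (m - i)) 0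
    rw [Nat.sub_sub_self (by omega)]

/-- **The iterated Cauchy product of all-ones lists is the complete-intersection count**:
`(∏_{t factors} (1 + t + ⋯ + t^{n−1}))[m] = ciHilbert [n, …, n] m`. [cite: Kloosterman2023, §2 eq. (1)] -/
theorem getD_foldl_pm_replicate (n t : ℕ) :
    ∀ m : ℕ, ((List.replicate t (List.replicate n 1)).foldl pm [1]).getD m 0 = ciHilbert (List.replicate t n) m := by
  induction t with
  | zero =>
    intro m
    rw [List.replicate_zero, List.foldl_nil, List.replicate_zero, ciHilbert_nil, getD_singleton_one]
  | succ t ih =>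
    intro m
    rw [List.replicate_succ', List.foldl_append, List.foldl_cons, List.foldl_nil,
      getD_pm_replicate_one pm hpm, List.replicate_succ, ciHilbert_cons]
    simp_rw [ih]

end Conv

/-- Euler: the partials of a nonsingular form of positive degree over `ℂ` have no common zero `x ≠ 0`
(if they all vanish at `x`, so does `f` by `Σ xᵢ ∂ᵢf = p·f`). [cite: VoisinHodgeII2003, §6.2.2 before Def. 6.18 (held text chunk p0165)] -/
theorem eq_zero_of_forall_eval_pderiv_eq_zero {p : ℕ} (hp : p ≠ 0) {f : MvPolynomial (Fin 3) ℂ}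
    (hf : f.IsHomogeneous p) (hfns : Literature.AlgebraicGeometry.Motives.SmoothHypersurface.IsNonsingularForm ℂ f)
    (x : Fin 3 → ℂ) (hx : ∀ i, MvPolynomial.eval x (MvPolynomial.pderiv i f) = 0) : x = 0 := by
  by_contra hx0
  have hfx : MvPolynomial.eval x f = 0 := by
    have he := congrArg (MvPolynomial.eval x) hf.sum_X_mul_pderiv
    rw [map_sum] at he
    simp only [map_mul, MvPolynomial.eval_X, hx, mul_zero, Finset.sum_const_zero, map_nsmul] at he
    rw [eq_comm, smul_eq_zero] at he
    exact he.resolve_left hp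
  obtain ⟨i, hi⟩ := hfns.exists_eval_pderiv_ne_zero hx0 hfx
  exact hi (hx i)

/-- **`stub_cyclicDeckHodge`** (registered signature of line `unitary-reflection-zariski` v5, verbatim):
clauses (iii) (invariant line) and (iv) (eigen-Hodge numbers `= ehn`) of `Deck` for the deck transformation of
a smooth `p`-cyclic cover of the plane branched along a nonsingular curve, from the two Carlson–Toledo facts.
[cite: CarlsonToledo1999, §2 and §5 (held text p0005, p0011–p0012)] [cite: VoisinHodgeII2003, §6.1.3 Cor. 6.12 and §6.2.2] -/
theorem stub_cyclicDeckHodge :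
    open Literature.AlgebraicGeometry.Motives Literature.AlgebraicGeometry.HodgeTheory Literature.AlgebraicGeometry.HodgeTheory.BettiUniverse CategoryTheory.Limits in let pmul : List ℕ → List ℕ → List ℕ := fun a b => (List.range (a.length + b.length - 1)).map fun k => ((List.range (k + 1)).map fun i => a.getD i 0 * b.getD (k - i) 0).sum; let ehn : ℕ → ℕ → ℕ → ℕ := fun p j q => if (q + 1) * p < 3 + j then 0 else ((List.replicate 3 (List.replicate (p - 1) 1)).foldl pmul [1]).getD ((q + 1) * p - 3 - j) 0; carlsonToledo1999_finrank_eigenspace_deck_one → carlsonToledo1999_finrank_eigenspace_inf_hodgePiece → ∀ ⦃p : ℕ⦄, p.Prime → 7 ≤ p → ∀ f : MvPolynomial (Fin 3) ℂ, f.IsHomogeneous p → f ≠ 0 → SmoothHypersurface.IsNonsingularForm ℂ f → ∀ (hXF : IsSmoothProjective 2 (SmoothHypersurface.hypersurface (MvPolynomial.X (Fin.last 3) ^ p - MvPolynomial.rename Fin.castSucc f))) (ha : (fun i : Fin 4 => if i = Fin.last 3 then (Units.mk0 (Complex.exp (2 * (Real.pi : ℂ) * Complex.I / (p : ℂ)))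 (Complex.exp_ne_zero _)) else 1) ∈ diagonalStabilizer (MvPolynomial.X (Fin.last 3) ^ p - MvPolynomial.rename Fin.castSucc f)), Module.finrank ℚ ↥(Module.End.eigenspace (pull (diagonalAut (MvPolynomial.X (Fin.last 3) ^ p - MvPolynomial.rename Fin.castSucc f) ha) 2) 1) = 1 ∧ ∃ ζ : ℂ, IsPrimitiveRoot ζ p ∧ ∀ j q : ℕ, 1 ≤ j → j < p → q ≤ 2 → Module.finrank ℂ ↥(Module.End.eigenspace ((pull (diagonalAut (MvPolynomial.X (Fin.last 3) ^ p - MvPolynomial.rename Fin.castSucc f) ha) 2).baseChange ℂ) (ζ ^ j) ⊓ (hodge exists_isReal_hodgeModel_holds hXF 2).piece ((2 : ℤ) - q) q) = ehn p j q := by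
  intro pmul ehn h₁ h₂ p hp h7 f hf hf0 hfns hXF ha
  have hpm : ∀ a b, pmul a b = (List.range (a.length + b.length - 1)).map fun k =>
      ((List.range (k + 1)).map fun i => a.getD i 0 * b.getD (k - i) 0).sum := fun a b => rfl
  have hp3 : 3 ≤ p := by omega
  refine ⟨h₁ hp3 f hf hf0 hXF ha, Complex.exp (2 * (Real.pi : ℂ) * Complex.I / (p : ℂ)),
    Complex.isPrimitiveRoot_exp p hp.ne_zero, ?_⟩
  intro j q hj hjp hq
  -- fact (2), stated with `cyclicCoverForm p f` (defeq to the raw spelling): compose up to unfolding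
  refine Eq.trans (h₂ Literature.AlgebraicGeometry.HodgeTheory.exists_isReal_hodgeModel_holds hp3 f hf hf0 hXF ha
    j q hj hjp hq) ?_
  show _ = (if (q + 1) * p < 3 + j then 0 else
    ((List.replicate 3 (List.replicate (p - 1) 1)).foldl pmul [1]).getD ((q + 1) * p - 3 - j) 0)
  by_cases hlt : (q + 1) * p < 3 + j
  · rw [if_pos hlt, if_pos hlt]
  rw [if_neg hlt, if_neg hlt]
  -- the Jacobian ring of the nonsingular ternary form `f` is Artinian
  obtain ⟨M, -, hXM⟩ := Literature.AlgebraicGeometry.HodgeTheory.exists_X_pow_mem_jacobianIdeal_ternary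
    (eq_zero_of_forall_eval_pderiv_eq_zero hp.ne_zero hf hfns)
  rw [Literature.AlgebraicGeometry.HodgeTheory.hilbert_jacobianIdeal_eq_card hf (by omega) hXM,
    getD_foldl_pm_replicate pmul hpm]
  have hc := Literature.AlgebraicGeometry.HodgeTheory.card_filter_finsuppAntidiag_eq_ciHilbert
    (fun _ : Fin 3 => p - 1) (fun _ => by omega) ((q + 1) * p - 3 - j)
  rw [List.ofFn_const] at hc
  simp_rw [show p - 1 - 1 = p - 2 by omega] at hc
  exact hc

end Summit.HodgeConjecture.HodgeConjecture.Theorems.CyclicUnitaryPowersDeckHodge
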